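import Literature.Claims.NS.ClayVariants
import Literature.Analysis.FluidPDE.CurlFreeLiouville
import Literature.Analysis.FluidPDE.PressurePoisson
import Literature.Analysis.FluidPDE.NSQuasipotential
import Literature.Analysis.FluidPDE.NSVorticityBKMHolds
import HarnessLib

/-!
# Claim skeleton C96 — C. Svancara, «Navier–Stokes Existence and Smoothness from the Generative
# Kernel — Finite-Time Blow-up Is Forbidden by the Genesis Threshold» (OSF egxnq, November 2025, 4 pp.)

UNREFEREED CLAIM under adjudication (cell `ns-claims`, D-0090) — NOTHING HERE ASSERTS A STEP: every
printed assertion is a `def … : Prop`; the only `theorem`s are kernel-checked relations between them and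
theorems of the tree. TEXT OF RECORD (RULINGS v1.33 (3), precedent C71 `Akysh2020`): OSF project egxnq
(created 2025-12-09), single file, PDF sha16 b764580eab7e30d2, 4 pp. (p.1 title, p.2 author/licence,
p.3–p.4 text; line numbers below = the pin's `pNNN.txt` lines; census pin `census/texts/Svancara2025/`,
lit lane `sources/Svancara2025/LOCATORS.md` 2c3e7d530c9539d5, ns-claims-lit-2 g4). The NUMBERED row's own
title (SSRN 5314232, «Navier–Stokes Existence and Smoothness via Relational Field Theory: A Formal Proof»)
is UNHELD and recorded as such; this later full-claim text of the same programme is what is typed.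
Lineage (CARD §1 only, not typed): the Zenodo original 17684457 is an HTTP-410 tombstone; OSF f3qh8
(2026-03-31) states «This work does not claim a solution to Navier–Stokes».

CLAIMED STATEMENT (p.4 l.1–8, «2 Formal Statement and Proof», prose, unnumbered): «For any smooth,
divergence-free initial data v₀ ∈ C∞(ℝ³) with finite energy, the 3D incompressible Navier–Stokes equations
derived from the Relational Kernel admit a unique global smooth solution v ∈ C∞([0,∞) × ℝ³).» Abstract
twin p.3 l.18–19: «Global smooth solutions exist for all time and all smooth, divergence-free,
finite-energy initial data.» THE MODEL SENTENCE (p.3 l.21–25): «Relational Field Theory contains only one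
field: R_c ∈ [0,1] obeying the Kernel identity Ω = Ω[R_c]. In the hydrodynamic regime, the incompressible
Navier–Stokes equations emerge as ∂ₜv + (v·∇)v = −∇p + νΔv, ∇·v = 0, with v ∝ ∇R_c (Axiom 6 …)» (abstract
l.12–13: «The velocity field v(x,t) emerges as the gradient flow of the single bounded coherence scalar
R_c ∈ [0,1]»). Direction: REGULARITY.

TWO READINGS, BOTH TYPED (the refuter keys; REF PRE-READ ns-claims-ref-4 g4, F1–F6):
* KERNEL reading — «derived from the Relational Kernel» imports the ansatz: data and solutions are kernel
  fields `v = κ∇R`, `R ∈ [0,1]` (`IsKernelField`, `IsKernelSolutionOn`). Typed as `ClaimedTheorem`. A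
  divergence-free kernel field is `0` (`div(κ∇R) = κΔR = 0`, `R` bounded ⇒ `R` constant by Liouville —
  PROVED below, `kernelField_eq_zero_of_isDivFree`), so the data/solution class of the derived system is
  `{0}` and `ClaimedTheorem` HOLDS with the rest state only (`claimedTheorem_holds`, PROVED): vacuity face.
* LITERAL reading — the abstract's sentence over ALL smooth divergence-free finite-energy data, with the
  ansatz «v ∝ ∇R_c» then a CLAIM about them (`Step1_Ansatz`, p.3 l.12–13 / l.25). Typed as
  `ClaimedTheoremLiteral` (existence) and `ClaimedUniquenessLiteral` (the word «unique»);
  `literal_of_step1 : Step1_Ansatz K → ClaimedTheoremLiteral` PROVED (under the ansatz every datum is `0`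
  and the rest state serves), so a kernel `¬ Step1_Ansatz K` is on this path.

CLAY DELTA (reference `ClayVariants.lean`, (A) = `clayR3.Regularity`): domain `ℝ³` «=»; viscosity `ν > 0`
(p.3 l.24, unquantified in print; typed `∀ ν > 0`) «=»; force `f ≡ 0` «=»; data class «smooth,
divergence-free, finite energy» ⊋ Clay (4) — good direction, no axis; conclusion `v ∈ C∞([0,∞) × ℝ³)`
WITHOUT the bounded-energy clause (7) (Δ6, alongside — `clay_of_literal` is NOT provable verbatim, as in
C93/C136); solution class of the KERNEL reading restricted to `{v = κ∇R_c} = {0}` (Δ on the solution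
class = the vacuity face, not a wrong-problem axis unless keyed there). `clay_of_claimed` is NOT provable
(the kernel theorem says nothing about non-zero data) and not drafted.

STEPS (print order):
* Step 1 `Step1_Ansatz` — p.3 l.12–13 / l.25 «v ∝ ∇R_c» as a claim over the literal data class: every
  smooth divergence-free finite-energy field is a kernel field. Typist's flag: known-false pattern (a
  compactly supported divergence-free field with non-zero curl is not a gradient; REF F2).
* Step 2 `Step2_BlowupCriterion` — p.4 l.9–13 (P1): «Assume … a maximal time of smoothness t* < ∞. Then
  lim sup_{t→t*⁻} ‖∇v(t)‖_{L∞} = ∞», typed for classical solutions of the unforced system on `[0,t*) × ℝ³`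
  from the theorem's data with no classical extension past `t*`. Support (BKM-type), not a token (F4).
* Step 3 `Step3_Correspondence` — p.4 l.13–16 (P2): «By the R_c ↔ v correspondence, this requires
  R_c(t) < R_th on a set of positive measure as t → t*⁻», at the functions grain of the ansatz
  (`v(t) = κ∇R(t)`, `R(t) ∈ [0,1]` on `[0,t*)`): unbounded `‖∇v‖_{L∞}` near `t*` forces
  `vol{R(t) < R_th} > 0` at some `t < t*`. Typist's flag: suspicious (F3: a bounded oscillating `R` has
  unbounded Hessian without dipping below `R_th`).
* Step 4 `Step4_Axiom4` — p.3 l.29–30, p.4 l.17 (P3): «Ω[R_c] is non-differentiable for R_c < R_th» —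
  AXIOM class over the opaque binder `Kernel.DiffAt`.
* Step 5 `Step5_Axiom2` — p.3 l.21–22 / l.31, p.4 l.17–18 (P4): every configuration of the field obeys
  the Kernel identity, which «forbids non-differentiable configurations» — AXIOM class.
* `NoFiniteMaximalTime` — p.4 l.18–19 «Hence t* = ∞»: no kernel solution on a half-open slab `[0,t*)`,
  `t* < ∞`, lacks a classical extension. `noFiniteMaximalTime_of_steps : Step2 → Step3 → Step4 → Step5 →
  NoFiniteMaximalTime` PROVED (the printed chain composes, by contradiction as printed).
* Step 6 `Step6_implicit` — UNPRINTED («admit a unique global smooth solution» needs an existence theory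
  in the kernel class and uniqueness; the printed proof only excludes blow-up of a given solution): the
  implicit step «no finite maximal time ⇒ every kernel datum has a unique global kernel solution».

COMPOSITION: `claim_of_steps : Step2 → Step3 → Step4 → Step5 → Step6_implicit → ClaimedTheorem` PROVED (the
printed chain + the implicit step); independently `claimedTheorem_holds : ClaimedTheorem` is PROVED
outright (the kernel class is `{0}`), and `literal_of_step1 : Step1_Ansatz K → ClaimedTheoremLiteral`
PROVED. `clay_of_claimed` / `clay_of_literal` NOT provable (Δ solution class / Δ6), not drafted.

## References
* C. Svancara, «Navier–Stokes Existence and Smoothness from the Generative Kernel», OSF egxnq (2025).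
  [`Svancara2025`]
* C. Fefferman, *Existence and smoothness of the Navier–Stokes equation*, CMI (2006), (A). [`FeffermanClay2006`]

WHAT THIS IS NOT: not a claim about NS regularity or blow-up; not a claim about any author beyond the
typed locator.
-/

open scoped ContDiff ENNReal Topology Laplacian
open Set MeasureTheory Filter

namespace Literature.Claims.NS.Svancara2025

open Literature.Analysis Literature.Analysis.FluidPDE Literature.Claims.NS.ClayVariants

/-- `ℝ³` (plumbing). [folklore] -/
abbrev E3 := EuclideanSpace ℝ (Fin 3)

/-! ## The Relational Kernel data (opaque binders — the text defines none of them, LOCATORS §7) -/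

/-- The Genesis Threshold «R_th ≃ 0.12» (abstract p.3 l.13–14), typed at the printed value.
[cite: Svancara2025, abstract p.3 l.13–14] -/
noncomputable def Rth : ℝ := 0.12

/-- The RFT objects the argument invokes but the text does not define: the proportionality constant of
the ansatz «v ∝ ∇R_c» (p.3 l.25) and the differentiability predicate of «the Kernel functional Ω[R_c]» at
a configuration `R_c : ℝ³ → [0,1]` (p.3 l.14–16, l.29–30; p.4 l.17). Opaque bookkeeping carrier; nothing
about it is asserted. [cite: Svancara2025, §1 p.3 l.21–31] -/
structure Kernel where
  /-- the constant in «v ∝ ∇R_c» (p.3 l.25) -/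
  κ : ℝ
  /-- «Ω[R_c] is differentiable at the configuration R_c» (p.3 l.14–16, l.29–30; p.4 l.17) -/
  DiffAt : (E3 → ℝ) → Prop

/-- A KERNEL FIELD: `v = κ∇R` for a smooth coherence scalar `R` with values in `[0,1]` (p.3 l.12–13 «the
velocity field v(x,t) emerges as the gradient flow of the single bounded coherence scalar R_c ∈ [0,1]»;
l.25 «v ∝ ∇R_c»). [cite: Svancara2025, p.3 l.12–13, l.21, l.25] -/
def IsKernelField (K : Kernel) (v : E3 → E3) : Prop :=
  ∃ R : E3 → ℝ, ContDiff ℝ ∞ R ∧ (∀ x, R x ∈ Icc (0 : ℝ) 1) ∧ v = fun x => K.κ • gradient R x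

/-- A solution of «the 3D incompressible Navier–Stokes equations DERIVED FROM THE RELATIONAL KERNEL»
(p.4 l.4–5 with p.3 l.23–25) on a time set `S ∋ 0` (`S = [0,∞)` or `[0,t*)`), from the datum `v₀`, with
its coherence scalar `R`: a classical solution of `∂ₜv + (v·∇)v = −∇p + νΔv`, `∇·v = 0` (`f = 0`; jointly
`C^∞` on `S × ℝ³`) with `v(0) = v₀`, every slice of which is the kernel field of the slice configuration
`R(t) ∈ [0,1]`. [cite: Svancara2025, p.3 l.21–25; p.4 l.1–8] -/
structure IsKernelSolutionOn (K : Kernel) (S : Set ℝ) (ν : ℝ) (v₀ : E3 → E3) (v : ℝ → E3 → E3)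
    (p : ℝ → E3 → ℝ) (R : ℝ → E3 → ℝ) : Prop where
  solves : IsClassicalNSSolutionOn S ν 0 v p
  initial : v 0 = v₀
  coherence_smooth : ∀ t ∈ S, ContDiff ℝ ∞ (R t)
  coherence_range : ∀ t ∈ S, ∀ x, R t x ∈ Icc (0 : ℝ) 1
  ansatz : ∀ t ∈ S, v t = fun x => K.κ • gradient (R t) x

/-- The theorem's data class (p.4 l.2–4): «smooth, divergence-free initial data v₀ ∈ C∞(ℝ³) with finite
energy». [cite: Svancara2025, p.4 l.2–4] -/
def IsDatum (v₀ : E3 → E3) : Prop :=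
  ContDiff ℝ ∞ v₀ ∧ NSWave0.IsDivFree v₀ ∧ ∫⁻ x, ‖v₀ x‖ₑ ^ 2 < ⊤

/-! ## The claimed statement — kernel reading and literal reading -/

/-- **§2 p.4 l.1–8, KERNEL reading** («the … Navier–Stokes equations derived from the Relational Kernel
admit a unique global smooth solution»): for every kernel, every `ν > 0` and every datum of the theorem's
class that is a kernel field, there is a kernel solution on `[0,∞) × ℝ³`, and any two kernel solutions from
that datum agree for `t ≥ 0`. [cite: Svancara2025, §2 p.4 l.1–8] [claim: Svancara2025, status: under-review] -/
def ClaimedTheorem : Prop :=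
  ∀ (K : Kernel) (ν : ℝ), 0 < ν → ∀ v₀ : E3 → E3, IsDatum v₀ → IsKernelField K v₀ →
    (∃ (v : ℝ → E3 → E3) (p : ℝ → E3 → ℝ) (R : ℝ → E3 → ℝ), IsKernelSolutionOn K (Ici 0) ν v₀ v p R) ∧
    ∀ (v v' : ℝ → E3 → E3) (p p' : ℝ → E3 → ℝ) (R R' : ℝ → E3 → ℝ),
      IsKernelSolutionOn K (Ici 0) ν v₀ v p R → IsKernelSolutionOn K (Ici 0) ν v₀ v' p' R' →
        ∀ t : ℝ, 0 ≤ t → v t = v' t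

/-- **§2 p.4 l.1–8 / abstract p.3 l.18–19, LITERAL reading, existence half**: for every `ν > 0` and every
smooth divergence-free finite-energy `v₀` there are `v, p`, jointly `C^∞` on `[0,∞) × ℝ³`, solving the
unforced system classically with `v(0) = v₀`. (No bounded-energy clause is printed: Δ6 to Clay (A).)
[cite: Svancara2025, §2 p.4 l.1–8; abstract p.3 l.18–19] [claim: Svancara2025, status: under-review] -/
def ClaimedTheoremLiteral : Prop :=
  ∀ ν : ℝ, 0 < ν → ∀ v₀ : E3 → E3, IsDatum v₀ →
    ∃ (v : ℝ → E3 → E3) (p : ℝ → E3 → ℝ), IsClassicalNSSolutionOn (Ici 0) ν 0 v p ∧ v 0 = v₀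

/-- **The word «unique» of p.4 l.5, LITERAL reading**: two jointly smooth global classical solutions of the
unforced system from the same datum agree for `t ≥ 0` (no decay or energy class printed for solutions).
Typist's flag: suspicious at this grain (no admissibility condition on solutions). Off the composition
path. [cite: Svancara2025, §2 p.4 l.5] [claim: Svancara2025, status: under-review] -/
def ClaimedUniquenessLiteral : Prop :=
  ∀ ν : ℝ, 0 < ν → ∀ v₀ : E3 → E3, IsDatum v₀ →
    ∀ (v v' : ℝ → E3 → E3) (p p' : ℝ → E3 → ℝ),
      IsClassicalNSSolutionOn (Ici 0) ν 0 v p → v 0 = v₀ →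
      IsClassicalNSSolutionOn (Ici 0) ν 0 v' p' → v' 0 = v₀ → ∀ t : ℝ, 0 ≤ t → v t = v' t

/-! ## The steps (print order) -/

/-- **Step 1 — the ansatz «v ∝ ∇R_c» (p.3 l.25; abstract l.12–13 «the velocity field v(x,t) emerges as the
gradient flow of the single bounded coherence scalar R_c ∈ [0,1]») AS A CLAIM over the literal data
class**: every smooth divergence-free finite-energy field on `ℝ³` is a kernel field. Typist's flag:
known-false pattern (a `C²` gradient has symmetric Jacobian; a compactly supported divergence-free field
with non-zero curl is not one). [cite: Svancara2025, p.3 l.12–13, l.25] [claim: Svancara2025, status: under-review] -/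
def Step1_Ansatz (K : Kernel) : Prop :=
  ∀ v₀ : E3 → E3, IsDatum v₀ → IsKernelField K v₀

/-- **Step 2 — the blow-up criterion (p.4 l.9–13, P1)**: «Assume, for contradiction, a maximal time of
smoothness t* < ∞. Then lim sup_{t→t*⁻} ‖∇v(t)‖_{L∞} = ∞» — typed for classical solutions of the unforced
system on `[0,t*) × ℝ³` from the theorem's data that admit no classical extension past `t*`
(`HasSmoothExtensionPast`): `‖∇v‖` is unbounded on `[0,t*) × ℝ³`. Support step (BKM-type continuation),
plausible at the finite-energy grain. [cite: Svancara2025, §2 p.4 l.9–13] [claim: Svancara2025, status: under-review] -/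
def Step2_BlowupCriterion : Prop :=
  ∀ ν : ℝ, 0 < ν → ∀ (v₀ : E3 → E3) (v : ℝ → E3 → E3) (p : ℝ → E3 → ℝ) (tstar : ℝ), 0 < tstar →
    IsDatum v₀ → IsClassicalNSSolutionOn (Ico 0 tstar) ν 0 v p → v 0 = v₀ →
    ¬ HasSmoothExtensionPast ν 0 v tstar →
      ∀ M : ℝ, ∃ t ∈ Ico 0 tstar, ∃ x : E3, M < ‖fderiv ℝ (v t) x‖

/-- **Step 3 — «the R_c ↔ v correspondence» (p.4 l.13–16, P2)**: «this [lim sup ‖∇v‖_{L∞} = ∞ as t → t*⁻]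
requires R_c(t) < R_th on a set of positive measure as t → t*⁻», at the functions grain of the ansatz:
for a time-dependent configuration `R(t) ∈ [0,1]`, smooth in `x`, with `v(t) = κ∇R(t)` on `[0,t*)`, if
`‖∇v‖` is unbounded on `[0,t*) × ℝ³` then `vol{x : R(t,x) < R_th} > 0` for some `t ∈ [0,t*)`. Typist's
flag: suspicious (a bounded oscillating configuration has unbounded Hessian while staying above `R_th`).
[cite: Svancara2025, §2 p.4 l.13–16; p.3 l.26–29] [claim: Svancara2025, status: under-review] -/
def Step3_Correspondence (K : Kernel) : Prop :=
  ∀ (R : ℝ → E3 → ℝ) (v : ℝ → E3 → E3) (tstar : ℝ), 0 < tstar →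
    (∀ t ∈ Ico 0 tstar, ContDiff ℝ ∞ (R t)) → (∀ t ∈ Ico 0 tstar, ∀ x, R t x ∈ Icc (0 : ℝ) 1) →
    (∀ t ∈ Ico 0 tstar, v t = fun x => K.κ • gradient (R t) x) →
    (∀ M : ℝ, ∃ t ∈ Ico 0 tstar, ∃ x : E3, M < ‖fderiv ℝ (v t) x‖) →
      ∃ t ∈ Ico 0 tstar, 0 < volume {x : E3 | R t x < Rth}

/-- **Step 4 — Axiom 4 / the Genesis PDE (p.3 l.29–30 «Below R_th, the Genesis PDE activates and δΩ/δR_c →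
∞ — the functional becomes non-differentiable»; p.4 l.17 «Ω[R_c] is non-differentiable for R_c < R_th»)**:
a configuration that dips below `R_th` on a set of positive measure is not a differentiability point of
`Ω[·]`. AXIOM class (opaque binder `Kernel.DiffAt`). [cite: Svancara2025, p.3 l.29–30; p.4 l.17] [claim: Svancara2025, status: under-review] -/
def Step4_Axiom4 (K : Kernel) : Prop :=
  ∀ R : E3 → ℝ, 0 < volume {x : E3 | R x < Rth} → ¬ K.DiffAt R

/-- **Step 5 — Axiom 2 / the Kernel identity (p.3 l.21–22 «R_c ∈ [0,1] obeying the Kernel identity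
Ω = Ω[R_c]», l.31 «Such a configuration lies outside the domain of the Kernel identity (Axiom 2). It is
forbidden», p.4 l.17–18 «The fixed-point identity Ω = Ω[R_c] cannot hold»)**: every configuration of the
coherence scalar of a kernel solution is a differentiability point of `Ω[·]`. AXIOM class.
[cite: Svancara2025, p.3 l.21–22, l.31; p.4 l.17–18] [claim: Svancara2025, status: under-review] -/
def Step5_Axiom2 (K : Kernel) : Prop :=
  ∀ (ν : ℝ) (S : Set ℝ) (v₀ : E3 → E3) (v : ℝ → E3 → E3) (p : ℝ → E3 → ℝ) (R : ℝ → E3 → ℝ),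
    IsKernelSolutionOn K S ν v₀ v p R → ∀ t ∈ S, K.DiffAt (R t)

/-- **«Hence t* = ∞» (p.4 l.18–19)**: no kernel solution from a datum of the theorem's class on a half-open
slab `[0,t*)`, `0 < t* < ∞`, lacks a classical extension past `t*`. (The conclusion of the printed proof by
contradiction; derived below from Steps 2–5.) [cite: Svancara2025, §2 p.4 l.18–19] [claim: Svancara2025, status: under-review] -/
def NoFiniteMaximalTime (K : Kernel) : Prop :=
  ∀ ν : ℝ, 0 < ν → ∀ (v₀ : E3 → E3) (v : ℝ → E3 → E3) (p : ℝ → E3 → ℝ) (R : ℝ → E3 → ℝ) (tstar : ℝ),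
    0 < tstar → IsDatum v₀ → IsKernelSolutionOn K (Ico 0 tstar) ν v₀ v p R →
      HasSmoothExtensionPast ν 0 v tstar

/-- **Step 6 (IMPLICIT, unprinted)** — what «admit a unique global smooth solution» (p.4 l.5) needs beyond
«t* = ∞»: an existence/continuation theory in the kernel class and uniqueness. Typed as the implication the
printed proof presupposes: if no kernel solution has a finite maximal time, then every kernel datum of the
theorem's class launches a global kernel solution, unique among kernel solutions. [cite: Svancara2025, §2 p.4 l.5, l.18–19 (implicit)] [claim: Svancara2025, status: under-review] -/
def Step6_implicit (K : Kernel) : Prop :=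
  NoFiniteMaximalTime K →
    ∀ ν : ℝ, 0 < ν → ∀ v₀ : E3 → E3, IsDatum v₀ → IsKernelField K v₀ →
      (∃ (v : ℝ → E3 → E3) (p : ℝ → E3 → ℝ) (R : ℝ → E3 → ℝ), IsKernelSolutionOn K (Ici 0) ν v₀ v p R) ∧
      ∀ (v v' : ℝ → E3 → E3) (p p' : ℝ → E3 → ℝ) (R R' : ℝ → E3 → ℝ),
        IsKernelSolutionOn K (Ici 0) ν v₀ v p R → IsKernelSolutionOn K (Ici 0) ν v₀ v' p' R' →
          ∀ t : ℝ, 0 ≤ t → v t = v' t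

/-! ## Composition of the printed chain (PROVED) -/

/-- **The printed proof by contradiction composes (p.4 l.9–19)**: Step 2 (blow-up criterion) ∧ Step 3
(correspondence) ∧ Step 4 (Axiom 4) ∧ Step 5 (Axiom 2) ⇒ «t* = ∞» for kernel solutions.
[cite: Svancara2025, §2 p.4 l.9–19] -/
theorem noFiniteMaximalTime_of_steps (K : Kernel) (h2 : Step2_BlowupCriterion)
    (h3 : Step3_Correspondence K) (h4 : Step4_Axiom4 K) (h5 : Step5_Axiom2 K) :
    NoFiniteMaximalTime K := by
  intro ν hν v₀ v p R tstar hts hd hsol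
  by_contra hnot
  -- (P1) the gradient blows up
  have hgrad := h2 ν hν v₀ v p tstar hts hd hsol.solves hsol.initial hnot
  -- (P2) the configuration dips below the threshold on a set of positive measure
  obtain ⟨t, ht, hvol⟩ :=
    h3 R v tstar hts hsol.coherence_smooth hsol.coherence_range hsol.ansatz hgrad
  -- (P3)+(P4) Axiom 4 versus the Kernel identity
  exact h4 (R t) hvol (h5 ν (Ico 0 tstar) v₀ v p R hsol t ht)

/-- **COMPOSITION (PROVED)**: the printed chain (Steps 2–5) and the implicit existence/uniqueness step give
the claimed statement in the kernel reading. [cite: Svancara2025, §2 p.4 l.1–19] -/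
theorem claim_of_steps (h2 : Step2_BlowupCriterion) (h3 : ∀ K, Step3_Correspondence K)
    (h4 : ∀ K, Step4_Axiom4 K) (h5 : ∀ K, Step5_Axiom2 K) (h6 : ∀ K, Step6_implicit K) :
    ClaimedTheorem :=
  fun K ν hν v₀ hd hk => h6 K (noFiniteMaximalTime_of_steps K h2 (h3 K) (h4 K) (h5 K)) ν hν v₀ hd hk

/-! ## The kernel class is `{0}` (PROVED): the vacuity face of the kernel reading -/

/-- **A divergence-free kernel field vanishes.** If `v = κ∇R` with `R : ℝ³ → [0,1]` smooth and `div v = 0`,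
then `v = 0`: for `κ ≠ 0`, `ΔR = κ⁻¹ div v = 0`, so `R` is a bounded harmonic function on `ℝ³`, hence
constant (Liouville, tree `HarmonicOnNhd.apply_eq_apply_of_abs_le`), and `∇R = 0`. No energy hypothesis is
needed. The vacuity face of the model sentence p.3 l.21–25 («R_c ∈ [0,1]», «∇·v = 0, with v ∝ ∇R_c»).
[cite: Svancara2025, §1 p.3 l.21–25] [cite: GilbargTrudinger2001, Thm 2.1 (Liouville)] -/
theorem kernelField_eq_zero_of_isDivFree (K : Kernel) {v : E3 → E3} (hv : IsKernelField K v)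
    (hdiv : NSWave0.IsDivFree v) : v = 0 := by
  obtain ⟨R, hR, hR01, rfl⟩ := hv
  by_cases hκ : K.κ = 0
  · funext x
    simp [hκ]
  -- `div (κ ∇R) = κ ΔR`
  have hR2 : ContDiff ℝ 2 R := hR.of_le (by norm_cast)
  have hgrad : ContDiff ℝ 1 (gradient R) :=
    (InnerProductSpace.toDual ℝ E3).symm.contDiff.comp (hR.fderiv_right (m := 1) (by norm_cast))
  have hΔ : ∀ x, (Δ R) x = 0 := fun x => by
    have h := hdiv x
    have hdx : DifferentiableAt ℝ (gradient R) x := hgrad.differentiable one_ne_zero x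
    have e : NSWave0.divergence (fun y => K.κ • gradient R y) x =
        K.κ * VectorCalculus.divergence (gradient R) x := by
      simp only [NSWave0.divergence, VectorCalculus.divergence]
      rw [show (fun y => K.κ • gradient R y) = K.κ • gradient R from rfl, fderiv_const_smul hdx,
        ContinuousLinearMap.toLinearMap_smul, map_smul, smul_eq_mul]
    rw [e, divergence_gradient hR2] at h
    rcases mul_eq_zero.1 h with h0 | h0
    · exact absurd h0 hκ
    · exact h0
  -- Liouville: `R` is constant
  have hharm : InnerProductSpace.HarmonicOnNhd R univ := harmonicOnNhd_of_laplacian_eq_zero hR2 hΔ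
  have hbdd : ∀ x, |R x| ≤ 1 := fun x => by
    rw [abs_of_nonneg (hR01 x).1]; exact (hR01 x).2
  have hconst : R = fun _ => R 0 := funext fun x => hharm.apply_eq_apply_of_abs_le hbdd x 0
  funext x
  rw [hconst]
  simp [gradient]

/-- **Every kernel solution is the rest state on its time set**: the slices are divergence-free kernel
fields (`IsClassicalNSSolutionOn.divFree` + the ansatz). [cite: Svancara2025, p.3 l.21–25 with p.4 l.4–5] -/
theorem kernelSolution_eq_zero {K : Kernel} {S : Set ℝ} {ν : ℝ} {v₀ : E3 → E3} {v : ℝ → E3 → E3}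
    {p : ℝ → E3 → ℝ} {R : ℝ → E3 → ℝ} (h : IsKernelSolutionOn K S ν v₀ v p R) {t : ℝ} (ht : t ∈ S) :
    v t = 0 :=
  kernelField_eq_zero_of_isDivFree K ⟨R t, h.coherence_smooth t ht, h.coherence_range t ht, h.ansatz t ht⟩
    (h.solves.divFree t ht)

/-- **A divergence-free kernel datum is zero** (the theorem's data class p.4 l.2–4 under the ansatz
p.3 l.25 is `{0}`). [cite: Svancara2025, p.4 l.2–4 with p.3 l.25] -/
theorem kernelDatum_eq_zero {K : Kernel} {v₀ : E3 → E3} (hd : IsDatum v₀) (hk : IsKernelField K v₀) :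
    v₀ = 0 :=
  kernelField_eq_zero_of_isDivFree K hk hd.2.1

/-- The rest state with the constant configuration `R ≡ 0` is a kernel solution from the zero datum on
every time set (the one inhabitant of the derived system's solution class, p.3 l.21–25 / p.4 l.4–5).
[cite: Svancara2025, p.3 l.21–25; p.4 l.4–5] -/
theorem isKernelSolutionOn_zero (K : Kernel) (S : Set ℝ) (ν : ℝ) :
    IsKernelSolutionOn K S ν 0 0 0 (fun _ _ => 0) where
  solves := isClassicalNSSolutionOn_zero S ν
  initial := rfl
  coherence_smooth _ _ := contDiff_const
  coherence_range _ _ _ := ⟨le_rfl, zero_le_one⟩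
  ansatz _ _ := by
    funext x
    simp [gradient]

/-- **The kernel reading of the claimed statement HOLDS — by vacuity of its class** (PROVED): the only
kernel datum of the theorem's class is `v₀ = 0` (`kernelDatum_eq_zero`), the rest state is a global kernel
solution (`isKernelSolutionOn_zero`), and every kernel solution is the rest state (`kernelSolution_eq_zero`).
This says nothing about any non-zero datum and nothing about Clay (A). [cite: Svancara2025, §2 p.4 l.1–8] -/
theorem claimedTheorem_holds : ClaimedTheorem := by
  intro K ν _ v₀ hd hk
  have h0 : v₀ = 0 := kernelDatum_eq_zero hd hk
  subst h0
  refine ⟨⟨0, 0, fun _ _ => 0, isKernelSolutionOn_zero K (Ici 0) ν⟩, ?_⟩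
  intro v v' p p' R R' hv hv' t ht
  rw [kernelSolution_eq_zero hv (mem_Ici.2 ht), kernelSolution_eq_zero hv' (mem_Ici.2 ht)]

/-- **«t* = ∞» also holds outright for kernel solutions** (they are the rest state, which extends
classically to every larger slab) — recorded so that the refuter sees that Steps 2–5 are not needed for the
kernel reading. [cite: Svancara2025, §2 p.4 l.18–19] -/
theorem noFiniteMaximalTime_holds (K : Kernel) : NoFiniteMaximalTime K := by
  intro ν _ v₀ v p R tstar hts _ hsol
  refine ⟨tstar + 1, by linarith, 0, 0, isClassicalNSSolutionOn_zero _ ν, fun t ht => ?_⟩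
  rw [kernelSolution_eq_zero hsol ht]
  rfl

/-! ## The literal reading through Step 1 (PROVED): the ansatz face is on the literal path -/

/-- **Step 1 ⇒ the literal existence sentence**: if every datum of the theorem's class were a kernel
field, every datum would be `0` (`kernelDatum_eq_zero`) and the rest state would be the global smooth
solution asked for. So a kernel `¬ Step1_Ansatz K` is type-exact on the literal path.
[cite: Svancara2025, abstract p.3 l.12–13, l.18–19; p.3 l.25] -/
theorem literal_of_step1 (K : Kernel) (h1 : Step1_Ansatz K) : ClaimedTheoremLiteral := by
  intro ν _ v₀ hd
  have h0 : v₀ = 0 := kernelDatum_eq_zero hd (h1 v₀ hd)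
  exact ⟨0, 0, isClassicalNSSolutionOn_zero _ ν, h0 ▸ rfl⟩

/-! ## Rev 2 (append-only; REF ref-4 g5 DELTA CHECK 2026-08-27T09:26:39Z, typing-hygiene flag on Step 2)

`Step2_BlowupCriterion` is typed over ALL classical solutions from `IsDatum` data with no energy clause on
the SOLUTION, so the parasitic family `u = g(t)e₁`, `p = −g′(t)x₁` (README ROUTE 5b, F3 artefact) makes it
kernel-false OUTSIDE the print's class («smooth solution» of finite-energy data, p.4 l.2–8) — never a
locator. The finite-energy face below adds `∫|v(t)|² < ∞` at every time of the slab, so that the BKM-type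
discharge (salvage lane) is stateable; the printed chain composes through it as well. Nothing of rev 1 is
touched; no verdict effect (REF: «refuter-2 g6: do not key there»). -/

/-- **Step 2, finite-energy face** (p.4 l.9–13 read inside the print's class p.4 l.2–8): as
`Step2_BlowupCriterion`, for classical solutions whose every slice on `[0,t*)` has finite energy.
[cite: Svancara2025, §2 p.4 l.9–13 with l.2–8] [claim: Svancara2025, status: under-review] -/
def Step2F_BlowupCriterionFinite : Prop :=
  ∀ ν : ℝ, 0 < ν → ∀ (v₀ : E3 → E3) (v : ℝ → E3 → E3) (p : ℝ → E3 → ℝ) (tstar : ℝ), 0 < tstar →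
    IsDatum v₀ → IsClassicalNSSolutionOn (Ico 0 tstar) ν 0 v p → v 0 = v₀ →
    (∀ t ∈ Ico 0 tstar, ∫⁻ x, ‖v t x‖ₑ ^ 2 < ⊤) →
    ¬ HasSmoothExtensionPast ν 0 v tstar →
      ∀ M : ℝ, ∃ t ∈ Ico 0 tstar, ∃ x : E3, M < ‖fderiv ℝ (v t) x‖

/-- The wide face implies the finite-energy face. [cite: Svancara2025, §2 p.4 l.9–13] -/
theorem step2F_of_step2 (h2 : Step2_BlowupCriterion) : Step2F_BlowupCriterionFinite :=
  fun ν hν v₀ v p tstar hts hd hsol h0 _ hne => h2 ν hν v₀ v p tstar hts hd hsol h0 hne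

/-- **The printed chain composes through the finite-energy face too** (kernel solutions are the rest
state, whose slices have energy `0`). [cite: Svancara2025, §2 p.4 l.9–19] -/
theorem noFiniteMaximalTime_of_stepsF (K : Kernel) (h2 : Step2F_BlowupCriterionFinite)
    (h3 : Step3_Correspondence K) (h4 : Step4_Axiom4 K) (h5 : Step5_Axiom2 K) :
    NoFiniteMaximalTime K := by
  intro ν hν v₀ v p R tstar hts hd hsol
  by_contra hnot
  have hfin : ∀ t ∈ Ico 0 tstar, ∫⁻ x, ‖v t x‖ₑ ^ 2 < ⊤ := fun t ht => by
    rw [kernelSolution_eq_zero hsol ht]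
    simp
  have hgrad := h2 ν hν v₀ v p tstar hts hd hsol.solves hsol.initial hfin hnot
  obtain ⟨t, ht, hvol⟩ :=
    h3 R v tstar hts hsol.coherence_smooth hsol.coherence_range hsol.ansatz hgrad
  exact h4 (R t) hvol (h5 ν (Ico 0 tstar) v₀ v p R hsol t ht)

/-- **COMPOSITION through the finite-energy face (PROVED).** [cite: Svancara2025, §2 p.4 l.1–19] -/
theorem claim_of_stepsF (h2 : Step2F_BlowupCriterionFinite) (h3 : ∀ K, Step3_Correspondence K)
    (h4 : ∀ K, Step4_Axiom4 K) (h5 : ∀ K, Step5_Axiom2 K) (h6 : ∀ K, Step6_implicit K) :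
    ClaimedTheorem :=
  fun K ν hν v₀ hd hk => h6 K (noFiniteMaximalTime_of_stepsF K h2 (h3 K) (h4 K) (h5 K)) ν hν v₀ hd hk

/-! ## Rev 3 (append-only; salvage-p3 g4 2026-08-27T09:30:46Z — the BKM-class face of Step 2, the grain
the tree certifies today)

The energy face (rev 2) removes the parasitic family but reaches no tree theorem; the Beale–Kato–Majda
reading of «smooth solution» (p.4 l.2–8: all `L²` Sobolev norms bounded on compact sub-slabs of `[0,t*)`)
is the class in which the continuation criterion is a theorem of the tree (BKM 1984 Thm 1,
`lintegral_iSup_curl_eq_top_of_not_hasSobolevExtensionPast_holds`). Typed with the binder order the salvage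
lane asked for, so that its Summits-side `…Svancara2025Salvage.step2_bkmClass_holds` ports in-file. Nothing
of rev 1–2 touched; no verdict effect. -/

/-- **Step 2, BKM-class face** (p.4 l.9–13 read inside p.4 l.2–8, «smooth solution» = all `L²` Sobolev
norms bounded on every `[0,T'']`, `T'' < t*`): no classical extension past `t*` ⇒ `‖∇v‖` unbounded on
`[0,t*) × ℝ³`. [cite: Svancara2025, §2 p.4 l.9–13 with l.2–8] [cite: BealeKatoMajda1984, Thm 1] [claim: Svancara2025, status: under-review] -/
def Step2_BlowupCriterionBKM : Prop :=
  ∀ ν : ℝ, 0 < ν → ∀ (v₀ : E3 → E3) (v : ℝ → E3 → E3) (p : ℝ → E3 → ℝ) (tstar : ℝ), 0 < tstar →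
    IsDatum v₀ → IsClassicalNSSolutionOn (Ico 0 tstar) ν 0 v p → v 0 = v₀ →
    (∀ T'' < tstar, HasBoundedSobolevNormsOn (Icc 0 T'') v) →
    ¬ HasSmoothExtensionPast ν 0 v tstar →
      ∀ M : ℝ, ∃ t ∈ Ico 0 tstar, ∃ x : E3, M < ‖fderiv ℝ (v t) x‖

/-- The wide face implies the BKM-class face. [cite: Svancara2025, §2 p.4 l.9–13] -/
theorem step2BKM_of_step2 (h2 : Step2_BlowupCriterion) : Step2_BlowupCriterionBKM :=
  fun ν hν v₀ v p tstar hts hd hsol h0 _ hne => h2 ν hν v₀ v p tstar hts hd hsol h0 hne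

/-- Kernel solutions lie in the BKM class on every compact sub-slab (they are the rest state there).
[cite: Svancara2025, p.3 l.21–25 with p.4 l.4–5] -/
theorem kernelSolution_hasBoundedSobolevNormsOn {K : Kernel} {ν : ℝ} {v₀ : E3 → E3} {v : ℝ → E3 → E3}
    {p : ℝ → E3 → ℝ} {R : ℝ → E3 → ℝ} {tstar : ℝ} (h : IsKernelSolutionOn K (Ico 0 tstar) ν v₀ v p R)
    {T'' : ℝ} (hT'' : T'' < tstar) : HasBoundedSobolevNormsOn (Icc 0 T'') v := by
  intro n
  refine ⟨0, fun t ht => ?_⟩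
  have hv : v t = 0 := kernelSolution_eq_zero h ⟨ht.1, ht.2.trans_lt hT''⟩
  have h0 : (0 : E3 → E3) = fun _ => (0 : E3) := rfl
  rw [hv, h0]
  simp

/-- **The printed chain composes through the BKM-class face too.** [cite: Svancara2025, §2 p.4 l.9–19] -/
theorem noFiniteMaximalTime_of_stepsBKM (K : Kernel) (h2 : Step2_BlowupCriterionBKM)
    (h3 : Step3_Correspondence K) (h4 : Step4_Axiom4 K) (h5 : Step5_Axiom2 K) :
    NoFiniteMaximalTime K := by
  intro ν hν v₀ v p R tstar hts hd hsol
  by_contra hnot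
  have hgrad := h2 ν hν v₀ v p tstar hts hd hsol.solves hsol.initial
    (fun T'' hT'' => kernelSolution_hasBoundedSobolevNormsOn hsol hT'') hnot
  obtain ⟨t, ht, hvol⟩ :=
    h3 R v tstar hts hsol.coherence_smooth hsol.coherence_range hsol.ansatz hgrad
  exact h4 (R t) hvol (h5 ν (Ico 0 tstar) v₀ v p R hsol t ht)

/-- **COMPOSITION through the BKM-class face (PROVED).** [cite: Svancara2025, §2 p.4 l.1–19] -/
theorem claim_of_stepsBKM (h2 : Step2_BlowupCriterionBKM) (h3 : ∀ K, Step3_Correspondence K)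
    (h4 : ∀ K, Step4_Axiom4 K) (h5 : ∀ K, Step5_Axiom2 K) (h6 : ∀ K, Step6_implicit K) :
    ClaimedTheorem :=
  fun K ν hν v₀ hd hk => h6 K (noFiniteMaximalTime_of_stepsBKM K h2 (h3 K) (h4 K) (h5 K)) ν hν v₀ hd hk

/-! ## Rev 4 (append-only; the BKM-class face DISCHARGED in-file — consumer of the tree's
Beale–Kato–Majda blow-up theorem; salvage-p3 g4 09:30:46Z route, ref-4 g5 09:39:13Z «support row»)

One import added (`Literature.Analysis.FluidPDE.NSVorticityBKMHolds`, for
`lintegral_iSup_curl_eq_top_of_not_hasSobolevExtensionPast_holds`); nothing of rev 1–3 touched. -/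

/-- **Step 2 at the standard grain is a theorem (PROVED; support step, not a locator).** In the
Beale–Kato–Majda class, no classical extension past `t*` forces `‖∇v‖` to be unbounded on
`[0,t*) × ℝ³`: otherwise `‖curl v‖ ≤ ‖curlCLM‖·‖∇v‖ ≤ ‖curlCLM‖·M` pointwise (`norm_curl_le`), so
`∫₀^{t*} ‖ω(t)‖_{L^∞} dt ≤ ‖curlCLM‖·M·t* < ∞`, contradicting BKM 1984 Thm 1 in its blow-up form
(`lintegral_iSup_curl_eq_top_of_not_hasSobolevExtensionPast_holds`, after
`HasSobolevExtensionPast.hasSmoothExtensionPast`). The datum, energy and `v 0 = v₀` binders are not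
used. Summits-side records of the same discharge (salvage-p3 g4): `…Theorems.Svancara2025Salvage.step2_bkmClass_holds`
(p519245) and its rev-2 alias onto this face; this is the in-file consumer twin.
[cite: Svancara2025, §2 p.4 l.9–13 with l.2–8] [cite: BealeKatoMajda1984, Thm 1] -/
theorem step2BKM_holds : Step2_BlowupCriterionBKM := by
  intro ν hν v₀ v p tstar hts _hd hsol _h0 hreg hne M
  by_contra hM
  push Not at hM
  have hmax : ¬ HasSobolevExtensionPast ν v tstar := fun h => hne h.hasSmoothExtensionPast
  have htop :=
    lintegral_iSup_curl_eq_top_of_not_hasSobolevExtensionPast_holds hν.le hts hsol hreg hmax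
  have hle : (∫⁻ t in Ioo 0 tstar, ⨆ x, ‖curl (v t) x‖ₑ) ≤
      ∫⁻ _ in Ioo 0 tstar, ENNReal.ofReal (‖curlCLM‖ * M) := by
    refine setLIntegral_mono measurable_const fun t ht => iSup_le fun x => ?_
    rw [← ofReal_norm]
    exact ENNReal.ofReal_le_ofReal ((norm_curl_le (v t) x).trans
      (mul_le_mul_of_nonneg_left (hM t ⟨ht.1.le, ht.2⟩ x) (norm_nonneg curlCLM)))
  have hfin : (∫⁻ _ in Ioo 0 tstar, ENNReal.ofReal (‖curlCLM‖ * M)) < (⊤ : ℝ≥0∞) := by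
    rw [setLIntegral_const, Real.volume_Ioo]
    exact ENNReal.mul_lt_top ENNReal.ofReal_lt_top ENNReal.ofReal_lt_top
  exact (ne_of_lt (hle.trans_lt hfin)) htop

/-- With Step 2 discharged at the BKM grain, the printed chain needs only Steps 3–5 (and the
implicit Step 6) as hypotheses. [cite: Svancara2025, §2 p.4 l.13–19] -/
theorem noFiniteMaximalTime_of_steps345 (K : Kernel) (h3 : Step3_Correspondence K)
    (h4 : Step4_Axiom4 K) (h5 : Step5_Axiom2 K) : NoFiniteMaximalTime K :=
  noFiniteMaximalTime_of_stepsBKM K step2BKM_holds h3 h4 h5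

/-- **COMPOSITION with Step 2 discharged (PROVED).** [cite: Svancara2025, §2 p.4 l.1–19] -/
theorem claim_of_steps3456 (h3 : ∀ K, Step3_Correspondence K) (h4 : ∀ K, Step4_Axiom4 K)
    (h5 : ∀ K, Step5_Axiom2 K) (h6 : ∀ K, Step6_implicit K) : ClaimedTheorem :=
  claim_of_stepsBKM step2BKM_holds h3 h4 h5 h6

end Literature.Claims.NS.Svancara2025
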